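import Summits.QuantumFields.YangMills.Theorems.BalabanUVNodesC44IterMhCauchy
import Literature.Analysis.Complex.CauchyTaylorBall
import HarnessLib

/-!
# (ℓa-C) ROAD B, FILE F4′-0 — THE (44) REMAINDER FROM DATA ALONG ONE TRACELESS COMPLEX LINE `t ↦ tX` (the edition F4′/F5 consume)

Cell `pub-ymgap` ∕ `ym-nodeO-ideate`, porter lineage `ymgap-nodeO-port-PTB-1` (gen 7), hand «(44) for `iterMh`» (director-ym g22 №569/№571; SPEC HOME
`ymgap-nodeO-port-PTB-1/HAND-SPEC-C44-iterMh.md` 877df2046bcf01aa + PORT-PLAN-v5 dc7ff9950b0ac185).  `--kind proof --supports stmt-QuantumFields-27238 --as helper`;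
count-neutral.  [B7] = [Balaban1985Averaging]; [B11] = [Balaban1985Variational]; [B12]∕[I] = [Balaban1987RG1].

WHY THIS EDITION (PORT-PLAN-v5 (F-α)).  F2′ ✓`norm_logChart_iterMh_sub_qCplxOp_le` asks for `DifferentiableOn ℂ G (ball 0 ρ)` and a bound on the FULL sup-ball of
`PBond → M_N(ℂ)`.  Along the SCALAR (trace) direction the holomorphic extension `iterMh` (ADJUGATES on backward steps: `adj(e^{ix}·1) = e^{i(N−1)x}·1`) is NOT k-uniformly
controlled, so that hypothesis cannot be discharged with k-free `(ρ, B)`; print never leaves `𝔤ᶜ = sl(N,ℂ)` ([B7] (109) «`A_b` belong to the complexified Lie algebra `𝔤ᶜ`»)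
and the letter of record is the traceless slice `CslOfRecord = COfRecord ∘ slProjLit`.  The Cauchy estimate is ONE-dimensional anyway: it needs `G` only ALONG the line
`t ↦ tX` through the traceless `X` — ℂ-differentiability of `G` AT the points `tX`, `|t| < R`, and a bound there.  That is what F4′ (k-free polydisc stability on TRACELESS
perturbations) delivers.

WHAT IS PROVED (0 def, 0 sorry, axioms standard; ns `Summit.QuantumFields.YangMills.Theorems.C44IterMh`), `G Y := logOver ↑Ū^k(U₀) (iterMh k (expOver U₀ Y))` under the guard:
* `differentiableOn_logChart_iterMh_line` — if `G` is ℂ-differentiable at every `tX` with `|t| < R`, then `t ↦ G(tX)` is ℂ-differentiable on `ball 0 R` (chain rule).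
* `deriv_logChart_iterMh_line_eq` — `deriv (t ↦ G(tX)) 0 = L^k • Q_k(U₀)X` for traceless `X` (F2′ ✓`fderiv_logChart_iterMh_apply_of_traceless` + the chain rule at `t = 0`).
* ★★★ `norm_logChart_iterMh_sub_qCplxOp_le_of_line` — `4 ≤ R`, `G` ℂ-differentiable at the points `tX` (`|t| < R`) with `‖G(tX)‖ ≤ B` there, `tr X_b = 0` ⇒
  `‖G X − L^k • Q_k(U₀) X‖ ≤ 8B∕R²` (lit ✓`CauchyTaylorBall.norm_sub_sub_le_of_forall_mem_ball` at `z = 1`, `G 0 = 0` ✓`logChart_iterMh_zero`).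
* ★★★ `norm_logChart_iterMh_sub_qCplxOp_le_of_linearBound` — THE CONSUMED SHAPE: if on the traceless sup-polydisc `L^k‖Y‖ < ρ₀` the chart is ℂ-differentiable with the
  LINEAR bound `‖G Y‖ ≤ C₀·L^k‖Y‖` (F4′'s output (b)), then for traceless `X` with `4·L^k‖X‖ ≤ ρ₀`:  `‖G X − L^k • Q_k(U₀)X‖ ≤ (8C₀∕ρ₀)·(L^k‖X‖)²` — [B11] (44)
  «`|C(A′)| ≤ C₂|A′|²`, `C₂` depends on `d, L` only» with `C₂ = 8C₀∕ρ₀` once `(ρ₀, C₀)` are k-free, for the scaled variable `L^kX = L^kη·A′ = A′` of the record.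

HONEST FRAMING.  One-variable Cauchy assembly; `(ρ₀, C₀)` are HYPOTHESES here (F4′ produces them); nothing of [B7] Props 1–3∕7 or [B11] (44)'s constant is proved in this
file.  (ℓa-C)(ℓa-H)(ℓd) DISPLAYED; (R1)∕(R2) OPEN; K0ᴬ ⟨stmt-QuantumFields-27238⟩ NOT closed; K0ᴬ∕K1ᴬ∕K3ᴬ 0∕3; NODE O 0∕1; COUNT 8∕28 · K 1∕4 UNMOVED; finite `𝕋⁴_{L^K}` at
fixed ε — NOT continuum ∕ ℝ⁴ ∕ OS; **the Yang–Mills mass gap (Clay) is NOT proved by any of this.**  No `sorry`, `instance`, `notation`, `set_option`; standard axioms.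
-/

noncomputable section

open scoped Matrix Matrix.Norms.L2Operator InnerProductSpace ComplexConjugate Topology
open NormedSpace (exp)
open Filter Metric Set

namespace Summit.QuantumFields.YangMills.Theorems.C44IterMh

open Literature.MathematicalPhysics.QuantumFieldTheory.Balaban1983to89
open Literature.MathematicalPhysics.QuantumFieldTheory.Balaban1983to89.Node00
open BlockAveraging
open B15AveragingHolomorphic (iterMh)
open ExpMeanLog (expMeanLogSU)
open T4Continuum
open Literature.Analysis.Complex (norm_sub_sub_le_of_forall_mem_ball)

variable {P : Params} {N : ℕ} [NeZero N]

/-- Along a line `t ↦ tX` through points where the log-averaged chart `G` is ℂ-differentiable, `t ↦ G(tX)` is ℂ-differentiable on the disc `|t| < R` (chain rule).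
[cite: Balaban1985Variational, (51)–(53) p.286; Balaban1987RG1, (0.8) p.253] -/
theorem differentiableOn_logChart_iterMh_line (U₀ : GaugeField P 0 (SU N)) (k : ℕ) {R : ℝ} (X : PBond P 0 → Matrix (Fin N) (Fin N) ℂ)
    (hdiff : ∀ t : ℂ, ‖t‖ < R → DifferentiableAt ℂ (fun Y : PBond P 0 → Matrix (Fin N) (Fin N) ℂ =>
      logOver (coeField (Averaging.iter (fun j => blockAvg (P := P) (j := j) expMeanLogSU) k U₀)) (iterMh k (expOver U₀ Y))) (t • X)) :
    DifferentiableOn ℂ (fun t : ℂ =>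
      logOver (coeField (Averaging.iter (fun j => blockAvg (P := P) (j := j) expMeanLogSU) k U₀)) (iterMh k (expOver U₀ (t • X)))) (ball 0 R) := by
  intro t ht
  rw [mem_ball_zero_iff] at ht
  have hline : DifferentiableAt ℂ (fun s : ℂ => s • X) t := differentiableAt_id.smul_const X
  exact ((hdiff t ht).comp t hline).differentiableWithinAt

/-- The derivative at `t = 0` of `t ↦ G(tX)` is `DG(0)X = L^k • Q_k(U₀)X` for TRACELESS `X` (F2′ ✓`fderiv_logChart_iterMh_apply_of_traceless` through the chain rule).
[cite: Balaban1985BackgroundPropagators, (3.13) p.393; Balaban1985Variational, (44) p.285] -/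
theorem deriv_logChart_iterMh_line_eq (U₀ : GaugeField P 0 (SU N)) {k : ℕ} (h : SmallBelow (fun j => blockAvg (P := P) (j := j) expMeanLogSU) k U₀)
    {X : PBond P 0 → Matrix (Fin N) (Fin N) ℂ} (hX : ∀ b, (X b).trace = 0)
    (hd : DifferentiableAt ℂ (fun Y : PBond P 0 → Matrix (Fin N) (Fin N) ℂ =>
      logOver (coeField (Averaging.iter (fun j => blockAvg (P := P) (j := j) expMeanLogSU) k U₀)) (iterMh k (expOver U₀ Y))) 0) :
    deriv (fun t : ℂ =>
      logOver (coeField (Averaging.iter (fun j => blockAvg (P := P) (j := j) expMeanLogSU) k U₀)) (iterMh k (expOver U₀ (t • X)))) 0 =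
      ((P.L : ℂ) ^ k) • qCplxOp k U₀ X := by
  set G := fun Y : PBond P 0 → Matrix (Fin N) (Fin N) ℂ =>
    logOver (coeField (Averaging.iter (fun j => blockAvg (P := P) (j := j) expMeanLogSU) k U₀)) (iterMh k (expOver U₀ Y)) with hG
  have hline : HasDerivAt (fun t : ℂ => t • X) X 0 := by
    have hl := (hasDerivAt_id (0 : ℂ)).smul_const X
    rw [one_smul] at hl
    exact hl
  have hF0 : HasFDerivAt G (fderiv ℂ G 0) ((0 : ℂ) • X) := by rw [zero_smul]; exact hd.hasFDerivAt
  have hcurve := hF0.comp_hasDerivAt (0 : ℂ) hline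
  rw [show (fun t : ℂ => G (t • X)) = G ∘ (fun t : ℂ => t • X) from rfl, hcurve.deriv, hG,
    fderiv_logChart_iterMh_apply_of_traceless U₀ h hd hX]

/-- ★★★ **THE (44) REMAINDER FROM ONE TRACELESS COMPLEX LINE.**  If `G Y := (1/i)·log(Ū^k_h(e^{iY}U₀)·Ū^k(U₀)⋆)` is ℂ-differentiable at every point `tX`, `|t| < R`
(`4 ≤ R`), with `‖G(tX)‖ ≤ B` there, and `tr X_b = 0`, then `‖G X − L^k • Q_k(U₀)X‖ ≤ 8B∕R²` — Cauchy's inequality for the second Taylor remainder of the one-variable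
holomorphic map `t ↦ G(tX)` at `t = 1` (lit ✓`CauchyTaylorBall.norm_sub_sub_le_of_forall_mem_ball`), `G 0 = 0` (F2′ ✓`logChart_iterMh_zero`), derivative `L^k • Q_k(U₀)X`
at `0`.  [B12] p.254: the transfer of [B7]'s estimates to any analytic average by Cauchy estimates along complex lines.
[cite: Balaban1985Variational, (44) p.285, (52)–(53) p.286; Balaban1987RG1, (0.8) p.253, p.254] -/
theorem norm_logChart_iterMh_sub_qCplxOp_le_of_line (U₀ : GaugeField P 0 (SU N)) {k : ℕ} (h : SmallBelow (fun j => blockAvg (P := P) (j := j) expMeanLogSU) k U₀)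
    {R B : ℝ} (hR : 4 ≤ R) {X : PBond P 0 → Matrix (Fin N) (Fin N) ℂ} (hX : ∀ b, (X b).trace = 0)
    (hdiff : ∀ t : ℂ, ‖t‖ < R → DifferentiableAt ℂ (fun Y : PBond P 0 → Matrix (Fin N) (Fin N) ℂ =>
      logOver (coeField (Averaging.iter (fun j => blockAvg (P := P) (j := j) expMeanLogSU) k U₀)) (iterMh k (expOver U₀ Y))) (t • X))
    (hB : ∀ t : ℂ, ‖t‖ < R →
      ‖logOver (coeField (Averaging.iter (fun j => blockAvg (P := P) (j := j) expMeanLogSU) k U₀)) (iterMh k (expOver U₀ (t • X)))‖ ≤ B) :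
    ‖logOver (coeField (Averaging.iter (fun j => blockAvg (P := P) (j := j) expMeanLogSU) k U₀)) (iterMh k (expOver U₀ X)) - ((P.L : ℂ) ^ k) • qCplxOp k U₀ X‖
      ≤ 8 * B / R ^ 2 := by
  have hRpos : 0 < R := by linarith
  set f := fun t : ℂ =>
    logOver (coeField (Averaging.iter (fun j => blockAvg (P := P) (j := j) expMeanLogSU) k U₀)) (iterMh k (expOver U₀ (t • X))) with hf
  have hfd : DifferentiableOn ℂ f (ball 0 R) := differentiableOn_logChart_iterMh_line U₀ k X hdiff
  have hfB : ∀ z ∈ ball (0 : ℂ) R, ‖f z‖ ≤ B := fun z hz => hB z (mem_ball_zero_iff.1 hz)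
  have hz : ‖(1 : ℂ) - 0‖ ≤ R / 4 := by rw [sub_zero, norm_one]; linarith
  have hc := norm_sub_sub_le_of_forall_mem_ball (f := f) (c := 0) hRpos hfd hfB hz
  have h0 : f 0 = 0 := by
    show logOver _ (iterMh k (expOver U₀ ((0 : ℂ) • X))) = 0
    rw [zero_smul]; exact logChart_iterMh_zero U₀ h
  have hd0 : DifferentiableAt ℂ (fun Y : PBond P 0 → Matrix (Fin N) (Fin N) ℂ =>
      logOver (coeField (Averaging.iter (fun j => blockAvg (P := P) (j := j) expMeanLogSU) k U₀)) (iterMh k (expOver U₀ Y))) 0 := by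
    have h00 := hdiff 0 (by rw [norm_zero]; exact hRpos)
    rwa [zero_smul] at h00
  have hderiv : deriv f 0 = ((P.L : ℂ) ^ k) • qCplxOp k U₀ X := deriv_logChart_iterMh_line_eq U₀ h hX hd0
  have h1 : f 1 = logOver (coeField (Averaging.iter (fun j => blockAvg (P := P) (j := j) expMeanLogSU) k U₀)) (iterMh k (expOver U₀ X)) := by
    show logOver _ (iterMh k (expOver U₀ ((1 : ℂ) • X))) = _
    rw [one_smul]
  rw [h0, hderiv, h1] at hc
  simp only [sub_zero, norm_one, one_smul, one_pow, mul_one] at hc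
  exact hc

/-- ★★★ **THE CONSUMED SHAPE — (44) FROM A LINEAR BOUND ON THE TRACELESS SCALED POLYDISC.**  Suppose that for every TRACELESS `Y` with `L^k‖Y‖ < ρ₀` the chart `G` is
ℂ-differentiable at `Y` and `‖G Y‖ ≤ C₀·L^k‖Y‖` (F4′'s k-free polydisc stability, outputs (a)(b)).  Then for every traceless `X` with `4·L^k‖X‖ ≤ ρ₀`:
`‖G X − L^k • Q_k(U₀)X‖ ≤ (8C₀∕ρ₀)·(L^k‖X‖)²` — [B11] (44) «`|C(A′)| ≤ C₂|A′|²`» with `C₂ = 8C₀∕ρ₀` in the scaled variable `A′ = L^kη·A′ = L^kX` of the record (`L^kη_k = 1`),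
k-free exactly when `(ρ₀, C₀)` are (they depend on `d, L, N` only in F4′). [cite: Balaban1985Variational, (44) p.285, Prop. 4 p.293 («depend on d and L only»); Balaban1987RG1, (0.8) p.253] -/
theorem norm_logChart_iterMh_sub_qCplxOp_le_of_linearBound (U₀ : GaugeField P 0 (SU N)) {k : ℕ} (h : SmallBelow (fun j => blockAvg (P := P) (j := j) expMeanLogSU) k U₀)
    {ρ₀ C₀ : ℝ} (hC₀ : 0 ≤ C₀)
    (hdiff : ∀ Y : PBond P 0 → Matrix (Fin N) (Fin N) ℂ, (∀ b, (Y b).trace = 0) → (P.L : ℝ) ^ k * ‖Y‖ < ρ₀ →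
      DifferentiableAt ℂ (fun Y : PBond P 0 → Matrix (Fin N) (Fin N) ℂ =>
        logOver (coeField (Averaging.iter (fun j => blockAvg (P := P) (j := j) expMeanLogSU) k U₀)) (iterMh k (expOver U₀ Y))) Y)
    (hbound : ∀ Y : PBond P 0 → Matrix (Fin N) (Fin N) ℂ, (∀ b, (Y b).trace = 0) → (P.L : ℝ) ^ k * ‖Y‖ < ρ₀ →
      ‖logOver (coeField (Averaging.iter (fun j => blockAvg (P := P) (j := j) expMeanLogSU) k U₀)) (iterMh k (expOver U₀ Y))‖ ≤ C₀ * ((P.L : ℝ) ^ k * ‖Y‖))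
    {X : PBond P 0 → Matrix (Fin N) (Fin N) ℂ} (hX : ∀ b, (X b).trace = 0) (hXρ : 4 * ((P.L : ℝ) ^ k * ‖X‖) ≤ ρ₀) :
    ‖logOver (coeField (Averaging.iter (fun j => blockAvg (P := P) (j := j) expMeanLogSU) k U₀)) (iterMh k (expOver U₀ X)) - ((P.L : ℂ) ^ k) • qCplxOp k U₀ X‖
      ≤ 8 * C₀ / ρ₀ * ((P.L : ℝ) ^ k * ‖X‖) ^ 2 := by
  have hLk : 0 < (P.L : ℝ) ^ k := pow_pos (Nat.cast_pos.2 P.L_pos) k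
  by_cases hX0 : X = 0
  · subst hX0
    rw [expOver_zero, ← B15AveragingHolomorphic.coeField_iter_eq_iterMh k h, logOver_coeField_self, map_zero, smul_zero, sub_zero, norm_zero]
    have hρ₀ : 0 ≤ ρ₀ := by rw [norm_zero, mul_zero, mul_zero] at hXρ; exact hXρ
    positivity
  have hXpos : 0 < ‖X‖ := norm_pos_iff.2 hX0
  set s : ℝ := (P.L : ℝ) ^ k * ‖X‖ with hs
  have hspos : 0 < s := mul_pos hLk hXpos
  have hρ₀ : 0 < ρ₀ := lt_of_lt_of_le (by positivity) hXρ
  -- the line through `X` stays in the polydisc for `|t| < R := ρ₀ / s`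
  set R : ℝ := ρ₀ / s with hR
  have hR4 : 4 ≤ R := by rw [hR, le_div_iff₀ hspos]; exact hXρ
  have htr : ∀ t : ℂ, ∀ b, ((t • X) b).trace = 0 := fun t b => by rw [Pi.smul_apply, Matrix.trace_smul, hX b, smul_zero]
  have hin : ∀ t : ℂ, ‖t‖ < R → (P.L : ℝ) ^ k * ‖t • X‖ < ρ₀ := by
    intro t ht
    rw [norm_smul, ← mul_assoc, mul_comm ((P.L : ℝ) ^ k) ‖t‖, mul_assoc, ← hs]
    rw [hR, lt_div_iff₀ hspos] at ht
    exact ht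
  have hB : ∀ t : ℂ, ‖t‖ < R →
      ‖logOver (coeField (Averaging.iter (fun j => blockAvg (P := P) (j := j) expMeanLogSU) k U₀)) (iterMh k (expOver U₀ (t • X)))‖ ≤ C₀ * ρ₀ := by
    intro t ht
    refine (hbound (t • X) (htr t) (hin t ht)).trans ?_
    exact mul_le_mul_of_nonneg_left (hin t ht).le hC₀
  have hmain := norm_logChart_iterMh_sub_qCplxOp_le_of_line U₀ h hR4 hX (fun t ht => hdiff (t • X) (htr t) (hin t ht)) hB
  refine hmain.trans (le_of_eq ?_)
  rw [hR]
  field_simp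

end Summit.QuantumFields.YangMills.Theorems.C44IterMh

end
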